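import Literature.NumberTheory.EllipticCurves.GoodReductionTorsionReductionProofs
import Literature.NumberTheory.EllipticCurves.SerreOpenImageOrdinaryInertiaProofs
import Literature.NumberTheory.EllipticCurves.LFunctionPrimeCoeff
import Literature.NumberTheory.EllipticCurves.CuspFormLFunction
import Literature.NumberTheory.EllipticCurves.Greenberg1999.TwoTorsionMuInvariant
import HarnessLib

/-!
# Route `TwoAdicConverse` (rung S3), crux `OrdLambdaHalfAtTwo` (item 19556), crux idea `gv-analytic-two`:
# FIRST LEMMA — the Eisenstein congruence modulo `4` of a curve with full rational `2`-torsion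

Cell `bsd-2adic` (run/shared/lean/pub/bsd-2adic/), seat `bsd-2adic-conv-1` (GEN 5). THEOREMS ONLY — no named fact, no
axiom, no definition, nothing conditional. HONEST FRAMING: this is the elementary ENTRY lemma of the crux idea
`gv-analytic-two` (Cruxes/OrdLambdaHalfAtTwo/Ideas/gv-analytic-two.md: Greenberg–Vatsal's analytic half at `p = 2` via the
Eisenstein congruence mod `4`); it proves nothing about `λ`-invariants; item 19556 / Kato's IMC at `2` stay OPEN class-wide;
BSD is not proved by any of this. PARTITION (D-0054): none — RANK axis (S3); companion formula cell X5@2 good-ord (B1·O1).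

**Statements** (`W/ℚ` a globally minimal elliptic curve, `ℓ` an ODD prime of GOOD reduction, `N_ℓ = #W̃(𝔽_ℓ) =
reductionPointCount W ℓ`, `a_ℓ = frobeniusTrace W ℓ = ℓ + 1 − N_ℓ`).
* `four_dvd_natCard_of_two_torsion_pair` / `two_dvd_natCard_of_two_torsion` — pure group theory: two distinct (resp.
  one) non-zero elements killed by `2` in an additive commutative group give `4 ∣ #M` (resp. `2 ∣ #M`) (Klein four-group
  `ℤ/2 × ℤ/2 ↪ M` via `ZMod.lift`, Lagrange; `#M := Nat.card M`, `0` if infinite).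
* `exists_point_padic_of_hasRationalTwoTorsionX` / `exists_mem_twoTorsion_padic_of_hasRationalTwoTorsionX` — a rational
  point of order `2` read in `E(ℚ_ℓ)[2] = ker [2]`; `dvd_reductionPointCount_of_dvd_natCard_twoTorsion_padic` — the
  transport `E(ℚ_ℓ)[2] ≃ W̃(𝔽_ℓ)[2] ≤ W̃(𝔽_ℓ)` (Silverman AEC VII.3.1(b); tree `WeierstrassCurve.nonempty_kerEquiv_reduction`,
  `ℓ ∤ 2Δ`): whatever divides `#E(ℚ_ℓ)[2]` divides `N_ℓ`.
* `two_dvd_reductionPointCount_of_hasRationalTwoTorsionX` / `even_frobeniusTrace_of_hasRationalTwoTorsionX` — ONE rational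
  point of order `2` gives `2 ∣ N_ℓ`, i.e. `a_ℓ ≡ 1 + ℓ ≡ 0 (mod 2)`: the MOD-`2` Eisenstein congruence `f_E ≡ E₂ (mod 2)`
  on the good Hecke operators (the reducible-`E[2]` habitat, 3 427 of the cell's 5 295 X5 classes).
* `four_dvd_reductionPointCount_of_hasRationalTwoTorsionX_pair` — TWO rational points of order `2` with distinct abscissae
  give `4 ∣ N_ℓ` (Klein four-group inside `E(ℚ_ℓ)[2] ≃ W̃(𝔽_ℓ)[2]`, Lagrange in `W̃(𝔽_ℓ)`).
* `four_dvd_succ_sub_frobeniusTrace_of_hasRationalTwoTorsionX_pair` — hence **`a_ℓ ≡ 1 + ℓ (mod 4)`**; and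
  **`eisensteinCongruenceModFour`** — the planner-typed first lemma `EisensteinCongruenceModFour` of the idea card VERBATIM
  (plan/ideas/SketchGV2.lean @43ec33fb154c1516): full rational `2`-torsion (three distinct abscissae) ⟹
  `4 ∣ ℓ + 1 − a_ℓ` at every odd good prime.
* `four_dvd_succ_sub_lFunction_of_hasRationalTwoTorsionX_pair` / `exists_cuspCoeff_eq_of_hasRationalTwoTorsionX_pair` —
  the same for the Dirichlet coefficient `a_ℓ(E)` of `L(E,s)` (`WeierstrassCurve.LFunction`) and for the `ℓ`-th Fourier
  coefficient of any newform `f` of `E` (`IsNewformOf W f`): `a_ℓ(f) = ℓ + 1 + 4m`, `m ∈ ℤ` — **`f_E ≡ E₂ (mod 4)` on the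
  Hecke operators `T_ℓ`, `ℓ ∤ 2N`**, the input of a Greenberg–Vatsal-type comparison of `2`-adic `L`-functions.

References: J. H. Silverman, *The Arithmetic of Elliptic Curves*, GTM 106 (2009), VII.3.1(b), VII.2.1, V.2.3.1
[SilvermanAEC2009]; R. Greenberg, V. Vatsal, Invent. Math. 142 (2000), §3 (the odd-`p` template) [GreenbergVatsal2000];
B. Mazur, *Modular curves and the Eisenstein ideal*, Publ. IHÉS 47 (1977), II.§9, II.§14 (the Eisenstein prime `2`)
[Mazur1977].
-/

set_option linter.dupNamespace false
set_option autoImplicit false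

noncomputable section

open scoped Classical
open WeierstrassCurve Literature.NumberTheory.EllipticCurves Literature.NumberTheory.EllipticCurves.Greenberg1999
  Literature.NumberTheory.EllipticCurves.ModularForms

namespace Summit.BirchSwinnertonDyer.BirchSwinnertonDyer.Theorems.TwoAdicTwistConverse

/-! ## §1. Group theory: two independent `2`-torsion elements force `4 ∣ #M` -/

section Klein

variable {M : Type*} [AddCommGroup M]

/-- The additive map `ℤ/2 → M`, `1 ↦ a`, for an element with `a + a = 0` (`ZMod.lift`). [folklore] -/
theorem exists_addMonoidHom_zmod_two_apply_one_eq (a : M) (ha : a + a = 0) : ∃ g : ZMod 2 →+ M, g 1 = a := by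
  have h1 : (1 : ZMod 2) = ((1 : ℤ) : ZMod 2) := by decide
  refine ⟨ZMod.lift 2 ⟨zmultiplesHom M a, by simp only [zmultiplesHom_apply, Nat.cast_ofNat, two_zsmul, ha]⟩, ?_⟩
  rw [h1, ZMod.lift_coe]
  simp

/-- **Two distinct non-zero elements killed by `2` span a Klein four-group, so `4 ∣ #M`** (Lagrange applied to the
injection `ℤ/2 × ℤ/2 ↪ M`, `(s, t) ↦ s·a + t·b`; `Nat.card`, so trivially true for infinite `M`). [folklore] -/
theorem four_dvd_natCard_of_two_torsion_pair {a b : M} (ha : a ≠ 0) (hb : b ≠ 0) (hab : a ≠ b)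
    (ha2 : a + a = 0) (hb2 : b + b = 0) : 4 ∣ Nat.card M := by
  obtain ⟨fa, hfa⟩ := exists_addMonoidHom_zmod_two_apply_one_eq a ha2
  obtain ⟨fb, hfb⟩ := exists_addMonoidHom_zmod_two_apply_one_eq b hb2
  let f : ZMod 2 × ZMod 2 →+ M := fa.coprod fb
  have hcases : ∀ s : ZMod 2, s = 0 ∨ s = 1 := by decide
  have hf : Function.Injective f := by
    rw [injective_iff_map_eq_zero]
    rintro ⟨s, t⟩ hst
    simp only [f, AddMonoidHom.coprod_apply] at hst
    have hnegb : -b = b := by rw [neg_eq_iff_add_eq_zero, hb2]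
    rcases hcases s with rfl | rfl <;> rcases hcases t with rfl | rfl
    · rfl
    · exfalso
      rw [map_zero, zero_add, hfb] at hst
      exact hb hst
    · exfalso
      rw [map_zero, add_zero, hfa] at hst
      exact ha hst
    · exfalso
      rw [hfa, hfb] at hst
      exact hab (by rw [eq_neg_of_add_eq_zero_left hst, hnegb])
  have h4 : Nat.card (ZMod 2 × ZMod 2) = 4 := by
    rw [Nat.card_prod, Nat.card_zmod]
  exact h4 ▸ AddSubgroup.card_dvd_of_injective f hf

/-- **A non-zero element killed by `2` gives `2 ∣ #M`** (its order is `2`; Lagrange). [folklore] -/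
theorem two_dvd_natCard_of_two_torsion {a : M} (ha : a ≠ 0) (ha2 : a + a = 0) : 2 ∣ Nat.card M := by
  have h : addOrderOf a = 2 := addOrderOf_eq_prime (by rw [two_nsmul, ha2]) ha
  rw [← h]
  exact addOrderOf_dvd_natCard a

end Klein

/-! ## §2. Rational `2`-torsion points read in `E(ℚ_ℓ)` -/

section Local

variable (W : WeierstrassCurve ℚ) [W.IsElliptic] [W.IsGloballyMinimal] (ℓ : ℕ) [Fact ℓ.Prime]

omit [W.IsGloballyMinimal] in
/-- A rational point of order `2` with abscissa `x` (`HasRationalTwoTorsionX W x`: `(x, y) ∈ E(ℚ)`, `2y + a₁x + a₃ = 0`),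
read in `E(ℚ_ℓ)`: a NON-ZERO point `P = (x, y)` of `W ⊗ ℚ_ℓ` with `P + P = O`. [cite: SilvermanAEC2009, III.2.3] -/
theorem exists_point_padic_of_hasRationalTwoTorsionX {x : ℚ} (hx : HasRationalTwoTorsionX W x) :
    ∃ (y : ℚ) (h : (W.baseChange ℚ_[ℓ]).toAffine.Nonsingular (x : ℚ_[ℓ]) (y : ℚ_[ℓ])),
      (Affine.Point.some _ _ h) + (Affine.Point.some _ _ h) = 0 := by
  obtain ⟨y, hxy, h2⟩ := hx
  have hxy' : (W.baseChange ℚ_[ℓ]).toAffine.Equation (x : ℚ_[ℓ]) (y : ℚ_[ℓ]) := by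
    have h := WeierstrassCurve.Affine.Equation.map (algebraMap ℚ ℚ_[ℓ]) hxy
    simp only [eq_ratCast] at h
    exact h
  have h : (W.baseChange ℚ_[ℓ]).toAffine.Nonsingular (x : ℚ_[ℓ]) (y : ℚ_[ℓ]) :=
    (WeierstrassCurve.Affine.equation_iff_nonsingular).mp hxy'
  have ha₁ : (W.baseChange ℚ_[ℓ]).toAffine.a₁ = (W.a₁ : ℚ_[ℓ]) := by
    simp only [WeierstrassCurve.baseChange, WeierstrassCurve.map_a₁, eq_ratCast]
  have ha₃ : (W.baseChange ℚ_[ℓ]).toAffine.a₃ = (W.a₃ : ℚ_[ℓ]) := by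
    simp only [WeierstrassCurve.baseChange, WeierstrassCurve.map_a₃, eq_ratCast]
  have h2' : 2 * (y : ℚ_[ℓ]) + (W.a₁ : ℚ_[ℓ]) * (x : ℚ_[ℓ]) + (W.a₃ : ℚ_[ℓ]) = 0 := by
    have := congrArg (fun r : ℚ ↦ (r : ℚ_[ℓ])) h2
    push_cast at this
    simpa using this
  have hneg : (y : ℚ_[ℓ]) = (W.baseChange ℚ_[ℓ]).toAffine.negY (x : ℚ_[ℓ]) (y : ℚ_[ℓ]) := by
    rw [WeierstrassCurve.Affine.negY, ha₁, ha₃]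
    linear_combination h2'
  exact ⟨y, h, WeierstrassCurve.Affine.Point.add_of_Y_eq rfl hneg⟩

omit [W.IsGloballyMinimal] in
/-- The same point as a NON-ZERO element of the `2`-torsion subgroup `E(ℚ_ℓ)[2] = ker [2]` with `a + a = 0`, whose
underlying point is `(x, y)`. [cite: SilvermanAEC2009, III.2.3] -/
theorem exists_mem_twoTorsion_padic_of_hasRationalTwoTorsionX {x : ℚ} (hx : HasRationalTwoTorsionX W x) :
    ∃ (y : ℚ) (h : (W.baseChange ℚ_[ℓ]).toAffine.Nonsingular (x : ℚ_[ℓ]) (y : ℚ_[ℓ]))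
      (a : (zsmulAddGroupHom ((2 : ℕ) : ℤ) : (W.baseChange ℚ_[ℓ]).toAffine.Point →+ _).ker),
      (a : (W.baseChange ℚ_[ℓ]).toAffine.Point) = Affine.Point.some _ _ h ∧ a ≠ 0 ∧ a + a = 0 := by
  obtain ⟨y, h, hP⟩ := exists_point_padic_of_hasRationalTwoTorsionX W ℓ hx
  have hmem : Affine.Point.some _ _ h ∈
      (zsmulAddGroupHom ((2 : ℕ) : ℤ) : (W.baseChange ℚ_[ℓ]).toAffine.Point →+ _).ker := by
    rw [AddMonoidHom.mem_ker, zsmulAddGroupHom_apply, natCast_zsmul, two_nsmul, hP]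
  refine ⟨y, h, ⟨_, hmem⟩, rfl, ?_, Subtype.ext hP⟩
  exact fun h0 ↦ WeierstrassCurve.Affine.Point.some_ne_zero h (congrArg Subtype.val h0)

/-- **Transport `E(ℚ_ℓ)[2] ≃ W̃(𝔽_ℓ)[2] ≤ W̃(𝔽_ℓ)`**: at an odd prime `ℓ` of good reduction, whatever divides
`#E(ℚ_ℓ)[2]` divides `N_ℓ = #W̃(𝔽_ℓ)` (Silverman AEC VII.3.1(b), VII.2.1: tree `nonempty_kerEquiv_reduction` for
`ℓ ∤ 2Δ_W`, then Lagrange and `natCard_point_padicModel_residue`). [cite: SilvermanAEC2009, VII.3.1(b) and VII.2.1] -/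
theorem dvd_reductionPointCount_of_dvd_natCard_twoTorsion_padic (hℓ : ℓ ≠ 2)
    (hgood : W.HasGoodReductionAtPrime ℓ) {d : ℕ}
    (hd : d ∣ Nat.card (zsmulAddGroupHom ((2 : ℕ) : ℤ) : (W.baseChange ℚ_[ℓ]).toAffine.Point →+ _).ker) :
    d ∣ W.reductionPointCount ℓ := by
  have hΔ : ¬ (ℓ : ℤ) ∣ minimalDiscriminantInt W :=
    not_dvd_minimalDiscriminantInt_of_hasGoodReductionAtPrime' W ℓ hgood
  have h2 : ¬ ℓ ∣ 2 := fun h ↦ hℓ ((Nat.prime_dvd_prime_iff_eq Fact.out Nat.prime_two).mp h)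
  obtain ⟨e⟩ := WeierstrassCurve.nonempty_kerEquiv_reduction (W := W) (q := ℓ) hΔ h2
  rw [Nat.card_congr e.toEquiv] at hd
  rw [← W.natCard_point_padicModel_residue ℓ]
  exact hd.trans (AddSubgroup.card_addSubgroup_dvd_card _)

/-- **Two rational points of order `2` with distinct abscissae give `4 ∣ #W̃(𝔽_ℓ)` at every odd prime `ℓ` of good
reduction** (`N_ℓ = reductionPointCount W ℓ`): the two points are distinct non-zero elements of `E(ℚ_ℓ)[2]`, which is
isomorphic to `W̃(𝔽_ℓ)[2]` for `ℓ ∤ 2Δ_W` (Silverman AEC VII.3.1(b), VII.2.1; tree `nonempty_kerEquiv_reduction`), so the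
Klein four-group they span gives `4 ∣ #W̃(𝔽_ℓ)[2] ∣ #W̃(𝔽_ℓ)` (Lagrange). [cite: SilvermanAEC2009, VII.3.1(b)] -/
theorem four_dvd_reductionPointCount_of_hasRationalTwoTorsionX_pair (hℓ : ℓ ≠ 2)
    (hgood : W.HasGoodReductionAtPrime ℓ) {x₁ x₂ : ℚ} (hx : x₁ ≠ x₂) (h₁ : HasRationalTwoTorsionX W x₁)
    (h₂ : HasRationalTwoTorsionX W x₂) : 4 ∣ W.reductionPointCount ℓ := by
  obtain ⟨y₁, hn₁, a, hav, ha, ha2⟩ := exists_mem_twoTorsion_padic_of_hasRationalTwoTorsionX W ℓ h₁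
  obtain ⟨y₂, hn₂, b, hbv, hb, hb2⟩ := exists_mem_twoTorsion_padic_of_hasRationalTwoTorsionX W ℓ h₂
  have hab : a ≠ b := by
    intro h
    have h' := congrArg Subtype.val h
    rw [hav, hbv, WeierstrassCurve.Affine.Point.some.injEq] at h'
    exact hx (Rat.cast_injective h'.1)
  exact dvd_reductionPointCount_of_dvd_natCard_twoTorsion_padic W ℓ hℓ hgood
    (four_dvd_natCard_of_two_torsion_pair ha hb hab ha2 hb2)

/-- **The Eisenstein congruence mod `4` at one prime: `a_ℓ ≡ 1 + ℓ (mod 4)`** for a globally minimal `E/ℚ` with two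
rational points of order `2` of distinct abscissae (equivalently `E[2] ⊂ E(ℚ)`) and an odd prime `ℓ` of good reduction
(`a_ℓ = frobeniusTrace W ℓ = ℓ + 1 − #W̃(𝔽_ℓ)`). [cite: SilvermanAEC2009, VII.3.1(b) and V.2.3.1] -/
theorem four_dvd_succ_sub_frobeniusTrace_of_hasRationalTwoTorsionX_pair (hℓ : ℓ ≠ 2)
    (hgood : W.HasGoodReductionAtPrime ℓ) {x₁ x₂ : ℚ} (hx : x₁ ≠ x₂) (h₁ : HasRationalTwoTorsionX W x₁)
    (h₂ : HasRationalTwoTorsionX W x₂) : (4 : ℤ) ∣ (ℓ : ℤ) + 1 - W.frobeniusTrace ℓ := by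
  have h := four_dvd_reductionPointCount_of_hasRationalTwoTorsionX_pair W ℓ hℓ hgood hx h₁ h₂
  rw [WeierstrassCurve.frobeniusTrace, sub_sub_cancel]
  exact_mod_cast h

/-- **`a_ℓ(E) ≡ 1 + ℓ (mod 4)` for the Dirichlet coefficient of `L(E, s)`** (`WeierstrassCurve.LFunction`; at a good prime
it is the trace of Frobenius, tree `LFunction_apply_prime_eq_frobeniusTrace`), same hypotheses.
[cite: SilvermanAEC2009, VII.3.1(b) and Exercise 8.19(a)] -/
theorem four_dvd_succ_sub_lFunction_of_hasRationalTwoTorsionX_pair (hℓ : ℓ ≠ 2)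
    (hgood : W.HasGoodReductionAtPrime ℓ) {x₁ x₂ : ℚ} (hx : x₁ ≠ x₂) (h₁ : HasRationalTwoTorsionX W x₁)
    (h₂ : HasRationalTwoTorsionX W x₂) : (4 : ℤ) ∣ (ℓ : ℤ) + 1 - W.LFunction ℓ := by
  rw [W.LFunction_apply_prime_eq_frobeniusTrace ℓ hgood]
  exact four_dvd_succ_sub_frobeniusTrace_of_hasRationalTwoTorsionX_pair W ℓ hℓ hgood hx h₁ h₂

/-- **`f_E ≡ E₂ (mod 4)` on `T_ℓ`**: for any newform `f` attached to `E` (`IsNewformOf W f`: `a_n(f) = a_n(E)` for all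
`n`), its `ℓ`-th Fourier coefficient is `ℓ + 1 + 4m` for some `m ∈ ℤ` — the `ℓ`-th coefficient of the weight-`2` Eisenstein
series being `σ₁(ℓ) = 1 + ℓ` — at every odd prime `ℓ` of good reduction, same hypotheses on `E`.
[cite: GreenbergVatsal2000, §3 (odd-p template: the Eisenstein congruence input)] [cite: SilvermanAEC2009, VII.3.1(b)] -/
theorem exists_cuspCoeff_eq_of_hasRationalTwoTorsionX_pair {N : ℕ} [NeZero N]
    {f : CuspForm (CongruenceSubgroup.Gamma0 N) 2} (hf : IsNewformOf W f) (hℓ : ℓ ≠ 2) (hgood : W.HasGoodReductionAtPrime ℓ) {x₁ x₂ : ℚ} (hx : x₁ ≠ x₂)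
    (h₁ : HasRationalTwoTorsionX W x₁) (h₂ : HasRationalTwoTorsionX W x₂) :
    ∃ m : ℤ, cuspCoeff f ℓ = (((ℓ : ℤ) + 1 + 4 * m : ℤ) : ℂ) := by
  obtain ⟨k, hk⟩ := four_dvd_succ_sub_lFunction_of_hasRationalTwoTorsionX_pair W ℓ hℓ hgood hx h₁ h₂
  refine ⟨-k, ?_⟩
  rw [hf.2 ℓ]
  have : W.LFunction ℓ = (ℓ : ℤ) + 1 + 4 * (-k) := by linear_combination -hk
  rw [this]

/-! ## §3. The mod-`2` congruence from ONE rational point of order `2` -/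

/-- **One rational point of order `2` gives `2 ∣ #W̃(𝔽_ℓ)`** at every odd prime `ℓ` of good reduction: it is a
non-zero element of `E(ℚ_ℓ)[2] ≃ W̃(𝔽_ℓ)[2]`, of order `2` (Lagrange). [cite: SilvermanAEC2009, VII.3.1(b)] -/
theorem two_dvd_reductionPointCount_of_hasRationalTwoTorsionX (hℓ : ℓ ≠ 2) (hgood : W.HasGoodReductionAtPrime ℓ)
    {x : ℚ} (hx : HasRationalTwoTorsionX W x) : 2 ∣ W.reductionPointCount ℓ := by
  obtain ⟨y, hn, a, -, ha, ha2⟩ := exists_mem_twoTorsion_padic_of_hasRationalTwoTorsionX W ℓ hx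
  exact dvd_reductionPointCount_of_dvd_natCard_twoTorsion_padic W ℓ hℓ hgood
    (two_dvd_natCard_of_two_torsion ha ha2)

/-- **The Eisenstein congruence mod `2`: `a_ℓ` is EVEN** (`a_ℓ ≡ 1 + ℓ ≡ 0 (mod 2)`) at every odd prime `ℓ` of good
reduction of a globally minimal `E/ℚ` with a rational point of order `2` — the reducible-`E[2]` habitat.
[cite: SilvermanAEC2009, VII.3.1(b) and V.2.3.1] -/
theorem even_frobeniusTrace_of_hasRationalTwoTorsionX (hℓ : ℓ ≠ 2) (hgood : W.HasGoodReductionAtPrime ℓ)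
    {x : ℚ} (hx : HasRationalTwoTorsionX W x) : Even (W.frobeniusTrace ℓ) := by
  have h := two_dvd_reductionPointCount_of_hasRationalTwoTorsionX W ℓ hℓ hgood hx
  have hodd : Odd ℓ := (Fact.out : ℓ.Prime).odd_of_ne_two hℓ
  rw [WeierstrassCurve.frobeniusTrace]
  have h2 : (2 : ℤ) ∣ (W.reductionPointCount ℓ : ℤ) := by exact_mod_cast h
  rw [even_iff_two_dvd]
  obtain ⟨k, hk⟩ := hodd
  obtain ⟨m, hm⟩ := h2
  exact ⟨(k : ℤ) + 1 - m, by rw [hm, hk]; push_cast; ring⟩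

end Local

/-! ## §4. The first lemma of the crux idea `gv-analytic-two`, verbatim -/

/-- **`EisensteinCongruenceModFour` (crux idea `gv-analytic-two` on item 19556, first lemma, VERBATIM the planner-typed
statement of plan/ideas/SketchGV2.lean): a globally minimal elliptic curve over `ℚ` all of whose `2`-torsion is rational
(three rational points of order `2` with pairwise distinct abscissae) has `a_ℓ ≡ ℓ + 1 (mod 4)` at every odd prime `ℓ` of
good reduction** — `E(ℚ)[2] ≅ (ℤ/2)²` injects into `W̃(𝔽_ℓ)`, so `4 ∣ #W̃(𝔽_ℓ) = ℓ + 1 − a_ℓ`; i.e. `f_E` is congruent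
modulo `4` to the weight-`2` Eisenstein series on the good Hecke operators. Only two of the three points are used.
[cite: SilvermanAEC2009, VII.3.1(b)] [cite: GreenbergVatsal2000, §3 (odd-p template)] -/
theorem eisensteinCongruenceModFour :
    ∀ (W : WeierstrassCurve ℚ) [W.IsElliptic] [W.IsGloballyMinimal],
      (∃ x₁ x₂ x₃ : ℚ, x₁ ≠ x₂ ∧ x₁ ≠ x₃ ∧ x₂ ≠ x₃ ∧ HasRationalTwoTorsionX W x₁ ∧
          HasRationalTwoTorsionX W x₂ ∧ HasRationalTwoTorsionX W x₃) →
      ∀ (ℓ : ℕ) [Fact ℓ.Prime], ℓ ≠ 2 → W.HasGoodReductionAtPrime ℓ →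
        (4 : ℤ) ∣ (ℓ : ℤ) + 1 - frobeniusTrace W ℓ := by
  intro W _ _ hfull ℓ _ hℓ hgood
  obtain ⟨x₁, x₂, x₃, h12, -, -, h₁, h₂, -⟩ := hfull
  exact four_dvd_succ_sub_frobeniusTrace_of_hasRationalTwoTorsionX_pair W ℓ hℓ hgood h12 h₁ h₂

end Summit.BirchSwinnertonDyer.BirchSwinnertonDyer.Theorems.TwoAdicTwistConverse

end
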